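import Summits.Ventures.PercRepro.PuncturedLYMAvoidBound

/-!
# PercRepro — (SP) BY SUPERPOSITION, PART 15: THE RECURSIVE CERTIFICATES ARE NONNEGATIVE — THE KEY TAIL INEQUALITY
(p10, gen 32)

The greedy (LP-optimal) certificates of PuncturedLYMChain / PuncturedLYMChainNeg are defined by the recursions
`λ_0 = e(0)/j`, `λ_{a+1} = (e(a+1) − (a+1)·λ_a)/(j − a − 1)` and `μ_0 = g(0)/(j − 1)`,
`μ_{a+1} = (g(a+1) − (a+1)·μ_a)/(j − 2 − a)` (`lamRec`, `muRec`), so that the certificate inequalities hold WITH EQUALITY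
(`lamRec_cert`, `muRec_cert`).  They are NONNEGATIVE, with `λ_a ≤ d(a)` and `μ_a ≤ g(a)/(j − 1 − a)` (`lamRec_nonneg_le`,
`muRec_nonneg_le`), because of THE KEY INEQUALITY `(a + 1)·d(a) ≤ (j − a − 1)·d(a + 1)` (`key_dFlux`), i.e.
`(j − a)·C_{≤a} ≤ (n − 2j + a)·C_{≤a+1}` on the hypergeometric partial sums (`star_cumCount`): trivial when
`j − a ≤ n − 2j + a`, and otherwise a geometric-tail estimate — the class counts satisfy
`c_i·(j − i)·(j + 1 − i) = (i + 1)·(n − 2j + i)·c_{i+1}` (`classCount_mul_succ`), so below the mode each class is at most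
`r = (a+1)(n−2j+a)/((j−a)(j+1−a)) < 1` times the next one and `(1 − r)·C_{≤a} ≤ r·c_{a+1}`.
Nothing here asserts (SP) in general; the closed-form sums of these certificates are PuncturedLYMRecSum.
-/

namespace PercRepro.PuncturedLYM

open Finset

/-! ### The class-count ratio and the key tail inequality (natural numbers) -/

/-- `c_i·(j − i)·(j + 1 − i) = (i + 1)·(n − 2j + i)·c_{i+1}` for `i ≤ j` and `2j ≤ n`. -/
theorem classCount_mul_succ (n j i : ℕ) (hi : i ≤ j) (hn : 2 * j ≤ n) :
    classCount n j i * (j - i) * (j + 1 - i) = (i + 1) * (n - 2 * j + i) * classCount n j (i + 1) := by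
  unfold classCount
  have h1 := Nat.choose_succ_right_eq j i
  have h2 := Nat.choose_succ_right_eq (n - j) (j - i)
  have e1 : j + 1 - i = j - i + 1 := by omega
  have e2 : n - j - (j - i) = n - 2 * j + i := by omega
  have e3 : j + 1 - (i + 1) = j - i := by omega
  rw [e2] at h2
  rw [e1, e3]
  calc j.choose i * (n - j).choose (j - i + 1) * (j - i) * (j - i + 1)
      = (j.choose i * (j - i)) * ((n - j).choose (j - i + 1) * (j - i + 1)) := by ring
    _ = (j.choose (i + 1) * (i + 1)) * ((n - j).choose (j - i) * (n - 2 * j + i)) := by rw [h1, h2]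
    _ = (i + 1) * (n - 2 * j + i) * (j.choose (i + 1) * (n - j).choose (j - i)) := by ring

/-- **The key tail inequality**: `(j − a)·C_{≤a} ≤ (n − 2j + a)·C_{≤a+1}` for `a + 2 ≤ j` and `2j + 1 ≤ n`. -/
theorem star_cumCount (n j a : ℕ) (ha : a + 2 ≤ j) (hn : 2 * j + 1 ≤ n) :
    (j - a) * cumCount n j a ≤ (n - 2 * j + a) * cumCount n j (a + 1) := by
  have hcum : cumCount n j (a + 1) = cumCount n j a + classCount n j (a + 1) := by
    unfold cumCount
    rw [sum_range_succ]
  rcases Nat.lt_or_ge (n - 2 * j + a) (j - a) with hB | hA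
  · -- below the mode: `n + 2a < 3j`, so `2a + 2 ≤ j`
    have h2a : 2 * a + 2 ≤ j := by omega
    -- the ratio bound `B·c_i ≤ A·c_{i+1}` for `i ≤ a`
    have hratio : ∀ i, i ≤ a →
        ((j - a) * (j + 1 - a)) * classCount n j i ≤ ((a + 1) * (n - 2 * j + a)) * classCount n j (i + 1) := by
      intro i hi
      have hid := classCount_mul_succ n j i (by omega) (by omega)
      have h1 : (j - a) * (j + 1 - a) ≤ (j - i) * (j + 1 - i) := Nat.mul_le_mul (by omega) (by omega)
      have h2 : (i + 1) * (n - 2 * j + i) ≤ (a + 1) * (n - 2 * j + a) := Nat.mul_le_mul (by omega) (by omega)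
      calc ((j - a) * (j + 1 - a)) * classCount n j i ≤ ((j - i) * (j + 1 - i)) * classCount n j i :=
            Nat.mul_le_mul_right _ h1
        _ = classCount n j i * (j - i) * (j + 1 - i) := by ring
        _ = (i + 1) * (n - 2 * j + i) * classCount n j (i + 1) := hid
        _ ≤ ((a + 1) * (n - 2 * j + a)) * classCount n j (i + 1) := Nat.mul_le_mul_right _ h2
    -- summed: `B·C_{≤a} ≤ A·C_{≤a+1}`
    have hsum : ((j - a) * (j + 1 - a)) * cumCount n j a ≤ ((a + 1) * (n - 2 * j + a)) * cumCount n j (a + 1) := by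
      unfold cumCount
      rw [mul_sum, mul_sum]
      calc ∑ i ∈ range (a + 1), ((j - a) * (j + 1 - a)) * classCount n j i
          ≤ ∑ i ∈ range (a + 1), ((a + 1) * (n - 2 * j + a)) * classCount n j (i + 1) :=
            sum_le_sum (fun i hi => hratio i (by have := mem_range.1 hi; omega))
        _ ≤ ∑ i ∈ range (a + 1 + 1), ((a + 1) * (n - 2 * j + a)) * classCount n j i := by
            rw [sum_range_succ' (fun i => ((a + 1) * (n - 2 * j + a)) * classCount n j i) (a + 1)]
            exact Nat.le_add_right _ _
    -- the arithmetic: with `X = C_{≤a}`, `Y = c_{a+1}`, `A < B`: `(B − A)·X ≤ A·Y` and `A·(j − a) ≤ (n − 2j + a)·B`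
    set X := cumCount n j a with hX
    set Y := classCount n j (a + 1) with hY
    set A := (a + 1) * (n - 2 * j + a) with hAdef
    set B := (j - a) * (j + 1 - a) with hBdef
    set m := n - 2 * j + a with hm
    have hAB : A < B := by
      rw [hAdef, hBdef]
      apply Nat.mul_lt_mul_of_le_of_lt (by omega) (by omega) (by omega)
    have hcum' : cumCount n j (a + 1) = X + Y := hcum
    rw [hcum'] at hsum ⊢
    -- `(B − A)·X ≤ A·Y`
    have h1 : (B - A) * X ≤ A * Y := by
      have : B * X ≤ A * X + A * Y := by rw [← mul_add]; exact hsum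
      have e : B * X = (B - A) * X + A * X := by
        rw [← add_mul, Nat.sub_add_cancel hAB.le]
      omega
    -- `A·(j − a) ≤ m·B`
    have h2 : A * (j - a) ≤ m * B := by
      rw [hAdef, hBdef]
      calc (a + 1) * m * (j - a) = m * ((j - a) * (a + 1)) := by ring
        _ ≤ m * ((j - a) * (j + 1 - a)) := Nat.mul_le_mul_left _ (Nat.mul_le_mul_left _ (by omega))
    -- the goal: `(j − a)·X ≤ m·(X + Y)`; write `j − a = K + m` with `K = (j − a) − m > 0`
    set K := (j - a) - m with hK
    have hjK : j - a = K + m := by omega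
    rw [hjK]
    -- `K·X ≤ m·Y`: multiply by `B − A > 0`
    have hKX : K * X ≤ m * Y := by
      have hBA : 0 < B - A := by omega
      apply Nat.le_of_mul_le_mul_left _ hBA
      -- `(B − A)·(K·X) ≤ K·A·Y ≤ (B − A)·(m·Y)`: `K·A ≤ (B − A)·m` from `h2`: `A·(K + m) ≤ m·B`
      have h3 : K * A ≤ (B - A) * m := by
        have : A * (K + m) ≤ m * B := hjK ▸ h2
        have e : m * B = (B - A) * m + A * m := by
          rw [← add_mul, Nat.sub_add_cancel hAB.le]; ring
        nlinarith
      calc (B - A) * (K * X) = K * ((B - A) * X) := by ring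
        _ ≤ K * (A * Y) := Nat.mul_le_mul_left _ h1
        _ = (K * A) * Y := by ring
        _ ≤ ((B - A) * m) * Y := Nat.mul_le_mul_right _ h3
        _ = (B - A) * (m * Y) := by ring
    calc (K + m) * X = K * X + m * X := by ring
      _ ≤ m * Y + m * X := Nat.add_le_add_right hKX _
      _ = m * (X + Y) := by ring
  · calc (j - a) * cumCount n j a ≤ (n - 2 * j + a) * cumCount n j a := Nat.mul_le_mul_right _ hA
      _ ≤ (n - 2 * j + a) * cumCount n j (a + 1) := by
          rw [hcum]
          exact Nat.mul_le_mul_left _ (Nat.le_add_right _ _)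

/-! ### The key inequality for the flux sequence -/

variable {α : Type} [Fintype α]

/-- `0 < c_a` for `a ≤ j` and `2j + 1 ≤ n`. -/
theorem classCount_pos {n j a : ℕ} (ha : a ≤ j) (hn : 2 * j + 1 ≤ n) : 0 < classCount n j a := by
  unfold classCount
  apply Nat.mul_pos (Nat.choose_pos ha) (Nat.choose_pos (by omega))

/-- `0 < cutEdges n j a` for `a < j`, `2j + 1 ≤ n`. -/
theorem cutEdges_pos {n j a : ℕ} (ha : a < j) (hn : 2 * j + 1 ≤ n) : 0 < cutEdges n j a := by
  unfold cutEdges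
  apply Nat.mul_pos (Nat.mul_pos (classCount_pos ha.le hn) (by omega)) (by omega)

/-- **The key inequality**: `(a + 1)·d(a) ≤ (j − a − 1)·d(a + 1)` for `a + 2 ≤ j`, `2j + 1 ≤ n`. -/
theorem key_dFlux {j a : ℕ} (ha : a + 2 ≤ j) (hn : 2 * j + 1 ≤ Fintype.card α) :
    ((a : ℚ) + 1) * dFlux α j a ≤ ((j : ℚ) - a - 1) * dFlux α j (a + 1) := by
  obtain ⟨n, hn_def⟩ : ∃ n, Fintype.card α = n := ⟨_, rfl⟩
  rw [hn_def] at hn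
  unfold dFlux
  rw [hn_def]
  have hτ : 0 ≤ tauQ α j := tauQ_nonneg (by rw [hn_def]; omega)
  have hce : (0 : ℚ) < cutEdges n j a := by exact_mod_cast cutEdges_pos (by omega) hn
  have hce' : (0 : ℚ) < cutEdges n j (a + 1) := by exact_mod_cast cutEdges_pos (by omega) hn
  have hstar := star_cumCount n j a ha hn
  have hid := classCount_mul_succ n j a (by omega) (by omega)
  -- cast the natural-number facts
  have hstar' : ((j : ℚ) - a) * cumCount n j a ≤ ((n : ℚ) - 2 * j + a) * cumCount n j (a + 1) := by
    have := (Nat.cast_le (α := ℚ)).2 hstar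
    push_cast [Nat.cast_sub (by omega : a ≤ j), Nat.cast_sub (by omega : 2 * j ≤ n)] at this
    linarith
  have hid' : (classCount n j a : ℚ) * ((j : ℚ) - a) * ((j : ℚ) + 1 - a) =
      ((a : ℚ) + 1) * ((n : ℚ) - 2 * j + a) * classCount n j (a + 1) := by
    have := congrArg (Nat.cast (R := ℚ)) hid
    push_cast [Nat.cast_sub (by omega : a ≤ j), Nat.cast_sub (by omega : a ≤ j + 1),
      Nat.cast_sub (by omega : 2 * j ≤ n)] at this
    linarith
  -- `cutEdges` unfolded
  have hcut : (cutEdges n j a : ℚ) = classCount n j a * ((j : ℚ) + 1 - a) * ((j : ℚ) - a) := by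
    unfold cutEdges
    push_cast [Nat.cast_sub (by omega : a ≤ j + 1), Nat.cast_sub (by omega : a ≤ j)]
    ring
  have hcut' : (cutEdges n j (a + 1) : ℚ) = classCount n j (a + 1) * ((j : ℚ) - a) * ((j : ℚ) - a - 1) := by
    unfold cutEdges
    have e1 : j + 1 - (a + 1) = j - a := by omega
    rw [e1]
    push_cast [Nat.cast_sub (by omega : a ≤ j), Nat.cast_sub (by omega : a + 1 ≤ j)]
    ring
  have hja : (0 : ℚ) < (j : ℚ) - a - 1 := by
    have : (a : ℚ) + 2 ≤ j := by exact_mod_cast ha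
    linarith
  have hja' : (0 : ℚ) < (j : ℚ) - a := by linarith
  have hc : (0 : ℚ) < classCount n j (a + 1) := by exact_mod_cast classCount_pos (by omega) hn
  have hm : (0 : ℚ) ≤ (n : ℚ) - 2 * j + a := by
    have : (2 * j + 1 : ℚ) ≤ n := by exact_mod_cast hn
    have : (0 : ℚ) ≤ a := by positivity
    linarith
  rw [← mul_div_assoc, ← mul_div_assoc, div_le_div_iff₀ hce hce']
  rw [hcut, hcut']
  -- target: `(a+1)·τ·C_{≤a}·(c_{a+1}(j−a)(j−a−1)) ≤ (j−a−1)·τ·C_{≤a+1}·(c_a(j+1−a)(j−a))`;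
  -- by `hid'`, `c_a (j+1−a)(j−a) = (a+1)(n−2j+a) c_{a+1}`, so it is `(a+1)(j−a)(j−a−1)·c_{a+1}·τ·[(j−a)... ]` — use `hstar'`
  have e : (classCount n j a : ℚ) * ((j : ℚ) + 1 - a) * ((j : ℚ) - a) =
      ((a : ℚ) + 1) * ((n : ℚ) - 2 * j + a) * classCount n j (a + 1) := by
    rw [← hid']; ring
  rw [e]
  have hmul := mul_le_mul_of_nonneg_left hstar' (by positivity : (0 : ℚ) ≤ ((a : ℚ) + 1) * tauQ α j * classCount n j (a + 1) * ((j : ℚ) - a - 1))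
  -- rearrange
  have lhs_eq : ((a : ℚ) + 1) * (tauQ α j * (cumCount n j a : ℚ)) * (classCount n j (a + 1) * ((j : ℚ) - a) * ((j : ℚ) - a - 1)) =
      ((a : ℚ) + 1) * tauQ α j * classCount n j (a + 1) * ((j : ℚ) - a - 1) * (((j : ℚ) - a) * cumCount n j a) := by ring
  have rhs_eq : ((j : ℚ) - a - 1) * (tauQ α j * (cumCount n j (a + 1) : ℚ)) * (((a : ℚ) + 1) * ((n : ℚ) - 2 * j + a) * classCount n j (a + 1)) =
      ((a : ℚ) + 1) * tauQ α j * classCount n j (a + 1) * ((j : ℚ) - a - 1) * (((n : ℚ) - 2 * j + a) * cumCount n j (a + 1)) := by ring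
  rw [lhs_eq, rhs_eq]
  exact hmul

/-! ### The recursive certificates -/

/-- The greedy profile certificate: `λ_0 = e(0)/j`, `λ_{a+1} = (e(a+1) − (a+1)·λ_a)/(j − a − 1)`. -/
def lamRec (α : Type) [Fintype α] (j : ℕ) : ℕ → ℚ
  | 0 => eDef α j 0 / j
  | a + 1 => (eDef α j (a + 1) - ((a : ℚ) + 1) * lamRec α j a) / ((j : ℚ) - a - 1)

/-- The greedy through-point certificate: `μ_0 = g(0)/(j − 1)`, `μ_{a+1} = (g(a+1) − (a+1)·μ_a)/(j − a − 2)`. -/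
def muRec (α : Type) [Fintype α] (j : ℕ) : ℕ → ℚ
  | 0 => gDef α j 0 / ((j : ℚ) - 1)
  | a + 1 => (gDef α j (a + 1) - ((a : ℚ) + 1) * muRec α j a) / ((j : ℚ) - a - 2)

/-- The profile certificate inequality holds with equality: `e(a) = (j − a)·λ_a + a·λ_{a−1}` for `a < j`. -/
theorem lamRec_cert {j : ℕ} (hj : 1 ≤ j) :
    ∀ a, a < j → eDef α j a ≤ ((j : ℚ) - a) * lamRec α j a + (a : ℚ) * lamRec α j (a - 1) := by
  intro a ha
  rcases a with _ | b
  · simp only [lamRec, Nat.cast_zero, sub_zero, zero_mul, add_zero]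
    have hj0 : (j : ℚ) ≠ 0 := by exact_mod_cast (by omega : j ≠ 0)
    rw [mul_div_cancel₀ _ hj0]
  · simp only [lamRec, Nat.add_sub_cancel]
    have hne : (j : ℚ) - b - 1 ≠ 0 := by
      have : (b : ℚ) + 2 ≤ j := by exact_mod_cast (by omega : b + 2 ≤ j)
      linarith
    push_cast
    have e : (j : ℚ) - (b + 1) = (j : ℚ) - b - 1 := by ring
    rw [e, mul_div_cancel₀ _ hne]
    linarith

/-- The through-point certificate inequality holds with equality: `g(a) = (j − 1 − a)·μ_a + a·μ_{a−1}` for `a + 2 ≤ j`. -/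
theorem muRec_cert {j : ℕ} :
    ∀ a, a + 2 ≤ j → gDef α j a ≤ ((j : ℚ) - 1 - a) * muRec α j a + (a : ℚ) * muRec α j (a - 1) := by
  intro a ha
  rcases a with _ | b
  · simp only [muRec, Nat.cast_zero, sub_zero, zero_mul, add_zero]
    have hne : (j : ℚ) - 1 ≠ 0 := by
      have : (2 : ℚ) ≤ j := by exact_mod_cast (by omega : 2 ≤ j)
      linarith
    rw [mul_div_cancel₀ _ hne]
  · simp only [muRec, Nat.add_sub_cancel]
    have hne : (j : ℚ) - b - 2 ≠ 0 := by
      have : (b : ℚ) + 3 ≤ j := by exact_mod_cast (by omega : b + 3 ≤ j)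
      linarith
    push_cast
    have e : (j : ℚ) - 1 - (b + 1) = (j : ℚ) - b - 2 := by ring
    rw [e, mul_div_cancel₀ _ hne]
    linarith

/-- **The profile certificate is nonnegative and at most `d(a)`**: `0 ≤ λ_a ≤ d(a)` for `a < j` (`2j + 1 ≤ n`). -/
theorem lamRec_nonneg_le {j : ℕ} (hn : 2 * j + 1 ≤ Fintype.card α) :
    ∀ a, a < j → 0 ≤ lamRec α j a ∧ lamRec α j a ≤ dFlux α j a := by
  have hjn : j ≤ Fintype.card α := by omega
  intro a
  induction a with
  | zero =>
    intro h0
    have hd := dFlux_nonneg (α := α) (j := j) (a := 0) hjn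
    have hj0 : (j : ℚ) ≠ 0 := by exact_mod_cast (by omega : j ≠ 0)
    have e : lamRec α j 0 = dFlux α j 0 := by
      simp only [lamRec, eDef, Nat.cast_zero, sub_zero]
      rw [mul_div_cancel_left₀ _ hj0]
    rw [e]
    exact ⟨hd, le_rfl⟩
  | succ b ih =>
    intro hb
    obtain ⟨h0, h1⟩ := ih (by omega)
    have hkey := key_dFlux (α := α) (j := j) (a := b) (by omega) hn
    have hd := dFlux_nonneg (α := α) (j := j) (a := b + 1) hjn
    have hpos : (0 : ℚ) < (j : ℚ) - b - 1 := by
      have : (b : ℚ) + 2 ≤ j := by exact_mod_cast (by omega : b + 2 ≤ j)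
      linarith
    have e : lamRec α j (b + 1) = (eDef α j (b + 1) - ((b : ℚ) + 1) * lamRec α j b) / ((j : ℚ) - b - 1) := rfl
    have he : eDef α j (b + 1) = ((j : ℚ) - b - 1) * dFlux α j (b + 1) := by
      unfold eDef
      push_cast
      ring
    rw [e, he]
    constructor
    · apply div_nonneg _ hpos.le
      have : ((b : ℚ) + 1) * lamRec α j b ≤ ((b : ℚ) + 1) * dFlux α j b :=
        mul_le_mul_of_nonneg_left h1 (by positivity)
      linarith
    · rw [div_le_iff₀ hpos]
      have : 0 ≤ ((b : ℚ) + 1) * lamRec α j b := mul_nonneg (by positivity) h0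
      linarith

/-- **The through-point certificate is nonnegative and at most `g(a)/(j − 1 − a)`**: for `a + 2 ≤ j` (`2j + 1 ≤ n`). -/
theorem muRec_nonneg_le {j : ℕ} (hn : 2 * j + 1 ≤ Fintype.card α) :
    ∀ a, a + 2 ≤ j → 0 ≤ muRec α j a ∧ muRec α j a * ((j : ℚ) - 1 - a) ≤ gDef α j a := by
  have hjn : j ≤ Fintype.card α := by omega
  have hn2 : 2 * j ≤ Fintype.card α := by omega
  intro a
  induction a with
  | zero =>
    intro h0
    have hg := gDef_nonneg (α := α) (j := j) (a := 0) hn2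
    have hne : (j : ℚ) - 1 ≠ 0 := by
      have : (2 : ℚ) ≤ j := by exact_mod_cast (by omega : 2 ≤ j)
      linarith
    have hpos : (0 : ℚ) < (j : ℚ) - 1 := by
      have : (2 : ℚ) ≤ j := by exact_mod_cast (by omega : 2 ≤ j)
      linarith
    have e : muRec α j 0 = gDef α j 0 / ((j : ℚ) - 1) := rfl
    rw [e]
    simp only [Nat.cast_zero, sub_zero]
    refine ⟨div_nonneg hg hpos.le, ?_⟩
    rw [div_mul_cancel₀ _ hne]
  | succ b ih =>
    intro hb
    obtain ⟨h0, h1⟩ := ih (by omega)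
    have hkey := key_dFlux (α := α) (j := j) (a := b) (by omega) hn
    have hd := dFlux_nonneg (α := α) (j := j) (a := b + 1) hjn
    have hd0 := dFlux_nonneg (α := α) (j := j) (a := b) hjn
    have hpos : (0 : ℚ) < (j : ℚ) - b - 2 := by
      have : (b : ℚ) + 3 ≤ j := by exact_mod_cast (by omega : b + 3 ≤ j)
      linarith
    have e : muRec α j (b + 1) = (gDef α j (b + 1) - ((b : ℚ) + 1) * muRec α j b) / ((j : ℚ) - b - 2) := rfl
    -- `g(b) = (n − 2j + b) d(b)`, `g(b+1) = (n − 2j + b + 1) d(b+1)`; from `h1`: `μ_b (j − 1 − b) ≤ g(b)`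
    have hg : gDef α j b = ((Fintype.card α : ℚ) - 2 * j + b) * dFlux α j b := rfl
    have hg' : gDef α j (b + 1) = ((Fintype.card α : ℚ) - 2 * j + b + 1) * dFlux α j (b + 1) := by
      unfold gDef
      push_cast
      ring
    have hm : (0 : ℚ) ≤ (Fintype.card α : ℚ) - 2 * j + b := by
      have : (2 * j + 1 : ℚ) ≤ Fintype.card α := by exact_mod_cast hn
      have : (0 : ℚ) ≤ b := by positivity
      linarith
    -- `(b+1)·μ_b ≤ (b+1)·g(b)/(j−1−b) ≤ (j−b−2)·g(b+1)/(j−1−b)`... we need `(b+1) μ_b ≤ g(b+1)`: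
    -- `(b+1)·μ_b·(j−1−b) ≤ (b+1)·g(b) = (b+1)(n−2j+b) d(b) ≤ (n−2j+b)(j−b−1) d(b+1) ≤ (j−1−b) g(b+1)`
    have hjb : (0 : ℚ) < (j : ℚ) - b - 1 := by linarith
    have step1 : ((b : ℚ) + 1) * muRec α j b * ((j : ℚ) - b - 1) ≤ ((b : ℚ) + 1) * gDef α j b := by
      have := mul_le_mul_of_nonneg_left h1 (by positivity : (0 : ℚ) ≤ (b : ℚ) + 1)
      linarith [this]
    have step2 : ((b : ℚ) + 1) * gDef α j b ≤ gDef α j (b + 1) * ((j : ℚ) - b - 1) := by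
      rw [hg, hg']
      have h1' := mul_le_mul_of_nonneg_left hkey hm
      have h2' : 0 ≤ ((j : ℚ) - b - 1) * dFlux α j (b + 1) := mul_nonneg hjb.le hd
      nlinarith [h1', h2']
    have hfin : ((b : ℚ) + 1) * muRec α j b ≤ gDef α j (b + 1) :=
      le_of_mul_le_mul_right (le_trans step1 step2) hjb
    rw [e]
    constructor
    · apply div_nonneg _ hpos.le
      linarith
    · rw [div_mul_eq_mul_div]
      have e2 : (j : ℚ) - 1 - ((b : ℚ) + 1) = (j : ℚ) - b - 2 := by ring
      push_cast
      rw [e2, mul_div_cancel_right₀ _ hpos.ne']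
      have : 0 ≤ ((b : ℚ) + 1) * muRec α j b := mul_nonneg (by positivity) h0
      linarith

end PercRepro.PuncturedLYM
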